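import Literature.NumberTheory.LFunctions.WeilSemilocalNegative
import Literature.NumberTheory.LFunctions.WeilExplicitContinuous
import HarnessLib

/-!
# No finite set of places carries support-free semi-local Weil positivity

For EVERY finite set `S` of primes the `S`-smooth semi-local Weil form
`Q_S(g) = Re W_{S ∪ {∞}}(g ⋆ g̃)` (`Literature.NumberTheory.LFunctions.weilSemilocalQuadratic`, the von Mangoldt sum
restricted to the `S`-units) is NEGATIVE on some test function, and indeed on every support cone `C(a)`, `a`
large (`exists_not_weilSemilocalPositivityOn`, `eventually_not_weilSemilocalPositivityOn`). Equivalently: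
there is no finite `S` with `WeilSemilocalPositivityOn S a` for all `a` (`not_exists_weilSemilocalPositivityOn_forall`).
This generalises the `S = {2}` rung `exists_not_weilSemilocalPositivityOn_two` (whose mechanism — dilation of an odd
test — only works while the prime mass `Σ_{p ∈ S} log p/(√p − 1)` stays below `log π − ψ(1/4) ≈ 5.37`, i.e. for
very small `S`).

## Mechanism (the polar term) [PROVED here]

Take the odd two-bump test `g_A(x) = φ(x − A) − φ(x + A)` with `φ = φ₀` the normalised smooth bump of radius `1`
(`WeilContinuous.moll 0`, even, `≥ 0`, `∫ φ = 1`). Then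
* polar term: `ĝ_A(0) = (e^{−A/2} − e^{A/2}) φ̂(0)` (`weilMellin_weilTranslate`), and `Re φ̂(0) = ∫ φ(y) e^{−y/2} dy
  ≥ e^{−1/2}`, so for odd `g_A` the polar term `−2|ĝ_A(0)|²` (`re_weilPolarTerm_weilConv_weilReflect_of_odd`) is
  `≤ −(A²/2)·|φ̂(0)|²`, i.e. tends to `−∞` (exponentially, but `A²` suffices);
* prime term: `|k| ≤ ‖g_A‖² ≤ 4‖φ‖²` (`norm_weilConv_weilReflect_le`) and the `S`-smooth mass
  `M_S = Σ_n Λ_S(n) n^{-1/2} = Σ_{p ∈ S} log p/(√p − 1) < ∞` (`summable_weilSemilocalCoeff`), so the prime term is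
  bounded by `8‖φ‖² M_S`, uniformly in `A`;
* archimedean term: `|ĝ_A(½+it)|² = |e^{itA} − e^{−itA}|² |φ̂(½+it)|² ≤ 4|φ̂(½+it)|²`, and `ρ(t) − ρ(0) ≥ 0`
  (`ρ(t) = Re ψ(1/4 + it/2)`, `reDigammaQuarter_zero_le`), `ρ(0) < 0`, whence
  `(1/2π)∫|ĝ_A|² ρ − log π ‖g_A‖² ≤ (2/π) ∫ |φ̂(½+it)|² (ρ(t) − ρ(0)) dt =: (2/π) C_φ`, uniformly in `A`.
Hence `Re Q_S(g_A) < 0` as soon as `A ≥ 2 (8‖φ‖² M_S + (2/π) C_φ)/|φ̂(0)|² + 1`, while `supp g_A ⊆ [−(A+1), A+1]`.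
For the full Weil functional the prime sum over ALL `n ≤ e^{2(A+1)}` has mass `≍ e^{A}` and compensates the polar
term (as it must under RH); the finiteness of `M_S` is exactly what a finite `S` cannot repair. The constants
`‖φ‖², C_φ, φ̂(0)` of Mathlib's (unspecified) bump are left symbolic: the statement is qualitative in `a`.

References: A. Connes, Selecta Math. 5 (1999) §VII Thm 4 (the S-local trace formula; no positivity is asserted
there — the present file shows none can hold support-free); E. Bombieri, Rend. Mat. Acc. Lincei (9) 11 (2000) §4
(translates `f + c f_x` of test functions, Lemma 2 `|f * g*| ≤ ‖f‖‖g‖`).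
-/

noncomputable section

open Complex MeasureTheory Set Filter Topology
open scoped Real ComplexConjugate

namespace Literature.NumberTheory.LFunctions

open Literature.Analysis.SpecialFunctions WeilContinuous

/-! ## The `S`-smooth prime mass is finite for every finite `S` -/

/-- A non-zero `{s}`-coefficient forces `s` prime and sits at a power of `s`. [folklore] -/
theorem weilSemilocalCoeff_singleton_ne_zero {s n : ℕ} (h : weilSemilocalCoeff {s} n ≠ 0) :
    s.Prime ∧ ∃ m : ℕ, n = s ^ m := by
  unfold weilSemilocalCoeff at h
  split_ifs at h with hsub
  · have hΛ : (ArithmeticFunction.vonMangoldt n : ℝ) ≠ 0 := by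
      intro h0; exact h (by rw [h0, zero_div])
    have hpp : IsPrimePow n := by
      by_contra hnp
      exact hΛ (ArithmeticFunction.vonMangoldt_eq_zero_iff.2 hnp)
    obtain ⟨p, m, hp, hm, rfl⟩ := (isPrimePow_nat_iff n).1 hpp
    have hpf : (p ^ m).primeFactors = {p} := Nat.primeFactors_prime_pow hm.ne' hp
    have hps : p ∈ ({s} : Finset ℕ) := hsub (by rw [hpf]; exact Finset.mem_singleton_self p)
    rw [Finset.mem_singleton] at hps
    subst hps
    exact ⟨hp, m, rfl⟩
  · exact absurd rfl h

/-- `√(s^m) = (√s)^m`. [folklore] -/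
theorem sqrt_natCast_pow (s m : ℕ) : Real.sqrt ((s ^ m : ℕ) : ℝ) = Real.sqrt s ^ m := by
  have h : ((s ^ m : ℕ) : ℝ) = (Real.sqrt s ^ m) ^ 2 := by
    rw [← pow_mul, mul_comm, pow_mul, Real.sq_sqrt (Nat.cast_nonneg s)]
    push_cast
    rfl
  rw [h, Real.sqrt_sq (by positivity)]

/-- At the powers of a prime `s`: `Λ_{{s}}(s^m) s^{-m/2} ≤ log s · (1/√s)^m` (equality for `m ≥ 1`, the left side is
`0` at `m = 0`). [folklore] -/
theorem weilSemilocalCoeff_singleton_pow_le {s : ℕ} (hs : s.Prime) (m : ℕ) :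
    weilSemilocalCoeff {s} (s ^ m) ≤ Real.log s * (Real.sqrt s)⁻¹ ^ m := by
  have hlog : 0 ≤ Real.log s := Real.log_nonneg (by exact_mod_cast hs.one_lt.le)
  rcases eq_or_ne m 0 with rfl | hm
  · rw [pow_zero, pow_zero, mul_one, weilSemilocalCoeff_of_not_isPrimePow _ not_isPrimePow_one]
    exact hlog
  · unfold weilSemilocalCoeff
    rw [if_pos (by rw [Nat.primeFactors_prime_pow hm hs]), ArithmeticFunction.vonMangoldt_apply_pow hm,
      ArithmeticFunction.vonMangoldt_apply_prime hs, sqrt_natCast_pow, inv_pow, div_eq_mul_inv]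

/-- The `{s}`-coefficients are summable, for every `s` (a geometric series along the powers of `s` if `s` is prime,
identically `0` otherwise). [folklore] -/
theorem summable_weilSemilocalCoeff_singleton (s : ℕ) : Summable (weilSemilocalCoeff {s}) := by
  by_cases hs : s.Prime
  · have hinj : Function.Injective (fun m : ℕ ↦ s ^ m) := Nat.pow_right_injective hs.two_le
    have hout : ∀ n ∉ Set.range (fun m : ℕ ↦ s ^ m), weilSemilocalCoeff {s} n = 0 := by
      intro n hn
      by_contra h
      obtain ⟨-, m, rfl⟩ := weilSemilocalCoeff_singleton_ne_zero h
      exact hn ⟨m, rfl⟩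
    refine (hinj.summable_iff hout).1 ?_
    have hr1 : (Real.sqrt s)⁻¹ < 1 := inv_lt_one_of_one_lt₀ (by
      rw [show (1 : ℝ) = Real.sqrt 1 by simp]
      exact Real.sqrt_lt_sqrt (by norm_num) (by exact_mod_cast hs.one_lt))
    have hgeo := summable_geometric_of_lt_one (inv_nonneg.2 (Real.sqrt_nonneg _)) hr1
    exact Summable.of_nonneg_of_le (fun m ↦ weilSemilocalCoeff_nonneg _ _)
      (fun m ↦ weilSemilocalCoeff_singleton_pow_le hs m) (hgeo.mul_left _)
  · have h0 : weilSemilocalCoeff {s} = 0 := by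
      funext n
      by_contra h
      exact hs (weilSemilocalCoeff_singleton_ne_zero h).1
    rw [h0]
    exact summable_zero

/-- `Λ_S(n)/√n ≤ Σ_{s ∈ S} Λ_{{s}}(n)/√n`: an `S`-smooth prime power `p^m` has `p ∈ S`. [folklore] -/
theorem weilSemilocalCoeff_le_sum_singleton (S : Finset ℕ) (n : ℕ) :
    weilSemilocalCoeff S n ≤ ∑ s ∈ S, weilSemilocalCoeff {s} n := by
  have hnn : ∀ s ∈ S, 0 ≤ weilSemilocalCoeff {s} n := fun s _ ↦ weilSemilocalCoeff_nonneg _ _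
  by_cases hpp : IsPrimePow n
  · obtain ⟨p, m, hp, hm, rfl⟩ := (isPrimePow_nat_iff n).1 hpp
    have hpf : (p ^ m).primeFactors = {p} := Nat.primeFactors_prime_pow hm.ne' hp
    by_cases hsub : (p ^ m).primeFactors ⊆ S
    · have hpS : p ∈ S := hsub (by rw [hpf]; exact Finset.mem_singleton_self p)
      have heq : weilSemilocalCoeff S (p ^ m) = weilSemilocalCoeff {p} (p ^ m) := by
        unfold weilSemilocalCoeff
        rw [if_pos hsub, if_pos (by rw [hpf])]
      rw [heq]
      exact Finset.single_le_sum hnn hpS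
    · have h0 : weilSemilocalCoeff S (p ^ m) = 0 := by
        unfold weilSemilocalCoeff
        rw [if_neg hsub]
      rw [h0]
      exact Finset.sum_nonneg hnn
  · rw [weilSemilocalCoeff_of_not_isPrimePow S hpp]
    exact Finset.sum_nonneg hnn

/-- **The `S`-smooth coefficients are summable for every finite `S`.** [folklore] -/
theorem summable_weilSemilocalCoeff (S : Finset ℕ) : Summable (weilSemilocalCoeff S) :=
  Summable.of_nonneg_of_le (fun _ ↦ weilSemilocalCoeff_nonneg _ _) (weilSemilocalCoeff_le_sum_singleton S)
    (summable_sum fun s _ ↦ summable_weilSemilocalCoeff_singleton s)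

/-- The `S`-smooth prime mass `M_S = Σ_n Λ_S(n) n^{-1/2}` (`= Σ_{p ∈ S} log p/(√p − 1)`). [folklore] -/
def weilSemilocalMass (S : Finset ℕ) : ℝ := ∑' n : ℕ, weilSemilocalCoeff S n

/-- `M_S ≥ 0`. [folklore] -/
theorem weilSemilocalMass_nonneg (S : Finset ℕ) : 0 ≤ weilSemilocalMass S :=
  tsum_nonneg fun _ ↦ weilSemilocalCoeff_nonneg _ _

/-- **Bound for the `S`-prime term** of a bounded kernel: `|Σ_n Λ_S(n) n^{-1/2} (k(log n) + k(−log n))| ≤ 2K · M_S`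
if `|k| ≤ K`. [folklore] -/
theorem norm_weilSemilocalPrimeTerm_le (S : Finset ℕ) {k : ℝ → ℂ} {K : ℝ} (hK : ∀ x, ‖k x‖ ≤ K) :
    ‖weilSemilocalPrimeTerm S k‖ ≤ 2 * K * weilSemilocalMass S := by
  have hK0 : 0 ≤ K := (norm_nonneg _).trans (hK 0)
  set f : ℕ → ℂ := fun n ↦ (weilSemilocalCoeff S n : ℂ) * (k (Real.log n) + k (-Real.log n)) with hf
  have hbound : ∀ n, ‖f n‖ ≤ weilSemilocalCoeff S n * (2 * K) := by
    intro n
    rw [hf, norm_mul, Complex.norm_real, Real.norm_of_nonneg (weilSemilocalCoeff_nonneg _ _)]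
    refine mul_le_mul_of_nonneg_left ?_ (weilSemilocalCoeff_nonneg _ _)
    calc ‖k (Real.log n) + k (-Real.log n)‖ ≤ ‖k (Real.log n)‖ + ‖k (-Real.log n)‖ := norm_add_le _ _
      _ ≤ K + K := add_le_add (hK _) (hK _)
      _ = 2 * K := by ring
  have hsum : Summable fun n ↦ weilSemilocalCoeff S n * (2 * K) :=
    (summable_weilSemilocalCoeff S).mul_right _
  have hnorm : Summable fun n ↦ ‖f n‖ :=
    Summable.of_nonneg_of_le (fun _ ↦ norm_nonneg _) hbound hsum
  unfold weilSemilocalPrimeTerm weilSemilocalMass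
  calc ‖∑' n, f n‖ ≤ ∑' n, ‖f n‖ := norm_tsum_le_tsum_norm hnorm
    _ ≤ ∑' n, weilSemilocalCoeff S n * (2 * K) := hnorm.tsum_le_tsum hbound hsum
    _ = (∑' n, weilSemilocalCoeff S n) * (2 * K) := tsum_mul_right
    _ = 2 * K * ∑' n, weilSemilocalCoeff S n := by ring

/-! ## The two-bump odd witness -/

namespace TwoBump

/-- `φ₀(−y) = φ₀(y)`. [folklore] -/
theorem moll_zero_neg (y : ℝ) : moll 0 (-y) = moll 0 y := by
  unfold moll; rw [ContDiffBump.normed_neg]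

/-- `φ₀(y) = 0` for `|y| ≥ 1`. [folklore] -/
theorem moll_zero_eq_zero {y : ℝ} (hy : 1 ≤ |y|) : moll 0 y = 0 :=
  moll_eq_zero (by rw [bump_rOut]; norm_num; exact hy)

/-- The witness `g_A(x) = φ₀(x − A) − φ₀(x + A)`. [cite: Bombieri2000Weil, §4 (the translates f + c·f_x)] -/
def gA (A : ℝ) : ℝ → ℂ := weilTranslate (moll 0) A - weilTranslate (moll 0) (-A)

/-- Pointwise form. [folklore] -/
theorem gA_apply (A x : ℝ) : gA A x = moll 0 (x - A) - moll 0 (x + A) := by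
  simp [gA, weilTranslate, sub_neg_eq_add]

/-- `g_A` is a test function. [folklore] -/
theorem isWeilTest_gA (A : ℝ) : IsWeilTest (gA A) :=
  ((isWeilTest_moll 0).weilTranslate A).sub ((isWeilTest_moll 0).weilTranslate (-A))

/-- `g_A` is odd. [folklore] -/
theorem gA_neg (A x : ℝ) : gA A (-x) = -gA A x := by
  rw [gA_apply, gA_apply, show -x - A = -(x + A) by ring, show -x + A = -(x - A) by ring, moll_zero_neg,
    moll_zero_neg]
  ring

/-- `g_A(x) = 0` for `|x| > A + 1` (`A ≥ 0`). [folklore] -/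
theorem gA_eq_zero {A x : ℝ} (hA : 0 ≤ A) (hx : A + 1 < |x|) : gA A x = 0 := by
  have h1 : 1 ≤ |x - A| := by
    have := abs_sub_abs_le_abs_sub x A
    rw [abs_of_nonneg hA] at this
    linarith
  have h2 : 1 ≤ |x + A| := by
    have := abs_sub_abs_le_abs_sub x (-A)
    rw [abs_neg, abs_of_nonneg hA, sub_neg_eq_add] at this
    linarith
  rw [gA_apply, moll_zero_eq_zero h1, moll_zero_eq_zero h2, sub_zero]

/-- `supp g_A ⊆ [−(A+1), A+1]`. [folklore] -/
theorem tsupport_gA_subset {A : ℝ} (hA : 0 ≤ A) : tsupport (gA A) ⊆ Icc (-(A + 1)) (A + 1) := by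
  refine closure_minimal (fun x hx ↦ ?_) isClosed_Icc
  have hx' : ¬ (A + 1 < |x|) := fun h ↦ hx (gA_eq_zero hA h)
  rw [not_lt, abs_le] at hx'
  exact ⟨hx'.1, hx'.2⟩

/-- Transform of the witness: `ĝ_A(s) = (e^{(s−1/2)A} − e^{−(s−1/2)A}) φ̂₀(s)`. [folklore] -/
theorem weilMellin_gA (A : ℝ) (s : ℂ) :
    weilMellin (gA A) s =
      (cexp ((s - 1 / 2) * A) - cexp ((s - 1 / 2) * ((-A : ℝ) : ℂ))) * weilMellin (moll 0) s := by
  have h1 := (isWeilTest_moll 0).weilTranslate A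
  have h2 := (isWeilTest_moll 0).weilTranslate (-A)
  rw [gA, weilMellin_sub h1.1.continuous h1.2 h2.1.continuous h2.2, weilMellin_weilTranslate,
    weilMellin_weilTranslate]
  ring

/-- At `s = 0`: `ĝ_A(0) = (e^{−A/2} − e^{A/2}) φ̂₀(0)`. [folklore] -/
theorem weilMellin_gA_zero (A : ℝ) :
    weilMellin (gA A) 0 = ((Real.exp (-(A / 2)) - Real.exp (A / 2) : ℝ) : ℂ) * weilMellin (moll 0) 0 := by
  rw [weilMellin_gA]
  have e1 : cexp (((0 : ℂ) - 1 / 2) * (A : ℂ)) = cexp (((-(A / 2) : ℝ)) : ℂ) := by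
    congr 1; push_cast; ring
  have e2 : cexp (((0 : ℂ) - 1 / 2) * ((-A : ℝ) : ℂ)) = cexp (((A / 2 : ℝ)) : ℂ) := by
    congr 1; push_cast; ring
  rw [e1, e2, ← Complex.ofReal_exp, ← Complex.ofReal_exp]
  push_cast
  ring

/-- On the critical line `|ĝ_A(1/2+it)|² ≤ 4 |φ̂₀(1/2+it)|²`. [folklore] -/
theorem norm_sq_weilMellin_gA_half_le (A t : ℝ) :
    ‖weilMellin (gA A) (1 / 2 + t * I)‖ ^ 2 ≤ 4 * ‖weilMellin (moll 0) (1 / 2 + t * I)‖ ^ 2 := by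
  rw [weilMellin_gA, norm_mul, mul_pow]
  refine mul_le_mul_of_nonneg_right ?_ (sq_nonneg _)
  have e1 : cexp ((1 / 2 + t * I - 1 / 2) * (A : ℂ)) = cexp (((t * A : ℝ)) * I) := by
    congr 1; push_cast; ring
  have e2 : cexp ((1 / 2 + t * I - 1 / 2) * ((-A : ℝ) : ℂ)) = cexp (((-(t * A) : ℝ)) * I) := by
    congr 1; push_cast; ring
  have hle : ‖cexp ((1 / 2 + t * I - 1 / 2) * (A : ℂ)) - cexp ((1 / 2 + t * I - 1 / 2) * ((-A : ℝ) : ℂ))‖ ≤ 2 := by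
    rw [e1, e2]
    calc _ ≤ ‖cexp (((t * A : ℝ)) * I)‖ + ‖cexp (((-(t * A) : ℝ)) * I)‖ := norm_sub_le _ _
      _ = 2 := by rw [Complex.norm_exp_ofReal_mul_I, Complex.norm_exp_ofReal_mul_I]; norm_num
  nlinarith [norm_nonneg (cexp ((1 / 2 + t * I - 1 / 2) * (A : ℂ)) -
    cexp ((1 / 2 + t * I - 1 / 2) * ((-A : ℝ) : ℂ)))]

/-- `Re φ̂₀(0) = ∫ φ₀(y) e^{−y/2} dy ≥ e^{−1/2}` (`φ₀ ≥ 0`, `∫ φ₀ = 1`, `supp φ₀ ⊆ [−1, 1]`). [folklore] -/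
theorem exp_neg_half_le_re_weilMellin_moll_zero : Real.exp (-(1 / 2)) ≤ (weilMellin (moll 0) 0).re := by
  set φ : ℝ → ℝ := (bump 0).normed volume with hφ
  have e : (fun t : ℝ ↦ moll 0 t * cexp (((0 : ℂ) - 1 / 2) * (t : ℂ))) =
      fun t : ℝ ↦ ((φ t * Real.exp (-(t / 2)) : ℝ) : ℂ) := by
    funext t
    rw [show ((0 : ℂ) - 1 / 2) * (t : ℂ) = ((-(t / 2) : ℝ) : ℂ) by push_cast; ring, ← Complex.ofReal_exp]
    unfold moll
    push_cast
    ring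
  have hM : weilMellin (moll 0) 0 = ((∫ t : ℝ, φ t * Real.exp (-(t / 2)) : ℝ) : ℂ) := by
    unfold weilMellin
    rw [e, integral_complex_ofReal]
  rw [hM, Complex.ofReal_re]
  have hφc : Continuous φ := (bump 0).continuous_normed
  have hφs : HasCompactSupport φ := (bump 0).hasCompactSupport_normed
  have hint1 : Integrable fun t : ℝ ↦ φ t * Real.exp (-(t / 2)) :=
    (hφc.mul (by fun_prop)).integrable_of_hasCompactSupport hφs.mul_right
  have hint0 : Integrable fun t : ℝ ↦ φ t * Real.exp (-(1 / 2)) := (bump 0).integrable_normed.mul_const _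
  have hone : ∫ t : ℝ, φ t * Real.exp (-(1 / 2)) = Real.exp (-(1 / 2)) := by
    rw [integral_mul_const, hφ, (bump 0).integral_normed, one_mul]
  rw [← hone]
  refine integral_mono hint0 hint1 fun t ↦ ?_
  have hφ0 : 0 ≤ φ t := (bump 0).nonneg_normed t
  by_cases ht : 1 ≤ |t|
  · have hz : φ t = 0 := by
      have h := moll_zero_eq_zero ht
      unfold moll at h
      exact_mod_cast h
    simp only [hz, zero_mul, le_refl]
  · refine mul_le_mul_of_nonneg_left (Real.exp_le_exp.2 ?_) hφ0
    rw [not_le, abs_lt] at ht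
    linarith [ht.1, ht.2]

/-- `|φ̂₀(0)|² > 0`. [folklore] -/
theorem norm_sq_weilMellin_moll_zero_pos : 0 < ‖weilMellin (moll 0) 0‖ ^ 2 := by
  have h := exp_neg_half_le_re_weilMellin_moll_zero
  have hre : (weilMellin (moll 0) 0).re ≤ ‖weilMellin (moll 0) 0‖ := Complex.re_le_norm _
  have := Real.exp_pos (-(1 / 2))
  nlinarith

/-- **Polar lower bound**: `|ĝ_A(0)|² ≥ (A/2)² |φ̂₀(0)|²` for `A ≥ 0` (`e^{A/2} − e^{−A/2} ≥ A/2`). [folklore] -/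
theorem sq_mul_le_norm_sq_weilMellin_gA_zero {A : ℝ} (hA : 0 ≤ A) :
    (A / 2) ^ 2 * ‖weilMellin (moll 0) 0‖ ^ 2 ≤ ‖weilMellin (gA A) 0‖ ^ 2 := by
  rw [weilMellin_gA_zero, norm_mul, mul_pow, Complex.norm_real, Real.norm_eq_abs, sq_abs]
  refine mul_le_mul_of_nonneg_right ?_ (sq_nonneg _)
  have h1 : A / 2 + 1 ≤ Real.exp (A / 2) := Real.add_one_le_exp _
  have h2 : Real.exp (-(A / 2)) ≤ 1 := by rw [Real.exp_le_one_iff]; linarith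
  have h3 : 0 < Real.exp (-(A / 2)) := Real.exp_pos _
  have h4 : A / 2 ≤ Real.exp (A / 2) - Real.exp (-(A / 2)) := by linarith
  have h5 : 0 ≤ A / 2 := by linarith
  calc (A / 2) ^ 2 ≤ (Real.exp (A / 2) - Real.exp (-(A / 2))) ^ 2 := pow_le_pow_left₀ h5 h4 2
    _ = (Real.exp (-(A / 2)) - Real.exp (A / 2)) ^ 2 := by ring

/-- `‖g_A‖² ≤ 4‖φ₀‖²`. [folklore] -/
theorem weilNorm2Sq_gA_le (A : ℝ) : weilNorm2Sq (gA A) ≤ 4 * weilNorm2Sq (moll 0) := by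
  have hm2 : Integrable fun x : ℝ ↦ ‖moll 0 x‖ ^ 2 := (isWeilTest_moll 0).integrable_norm_sq
  have hi1 : Integrable fun x : ℝ ↦ ‖moll 0 (x - A)‖ ^ 2 := hm2.comp_sub_right A
  have hi2 : Integrable fun x : ℝ ↦ ‖moll 0 (x + A)‖ ^ 2 := hm2.comp_add_right A
  have he1 : ∫ x : ℝ, ‖moll 0 (x - A)‖ ^ 2 = weilNorm2Sq (moll 0) :=
    integral_sub_right_eq_self (fun x : ℝ ↦ ‖moll 0 x‖ ^ 2) A
  have he2 : ∫ x : ℝ, ‖moll 0 (x + A)‖ ^ 2 = weilNorm2Sq (moll 0) :=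
    integral_add_right_eq_self (fun x : ℝ ↦ ‖moll 0 x‖ ^ 2) A
  unfold weilNorm2Sq at he1 he2 ⊢
  calc ∫ x : ℝ, ‖gA A x‖ ^ 2 ≤ ∫ x : ℝ, (2 * ‖moll 0 (x - A)‖ ^ 2 + 2 * ‖moll 0 (x + A)‖ ^ 2) := by
        refine integral_mono (isWeilTest_gA A).integrable_norm_sq ((hi1.const_mul 2).add (hi2.const_mul 2))
          fun x ↦ ?_
        simp only [gA_apply]
        have h := norm_sub_le (moll 0 (x - A)) (moll 0 (x + A))
        have h2 : ‖moll 0 (x - A) - moll 0 (x + A)‖ ^ 2 ≤ (‖moll 0 (x - A)‖ + ‖moll 0 (x + A)‖) ^ 2 :=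
          pow_le_pow_left₀ (norm_nonneg _) h 2
        nlinarith [sq_nonneg (‖moll 0 (x - A)‖ - ‖moll 0 (x + A)‖)]
    _ = 4 * ∫ x : ℝ, ‖moll 0 x‖ ^ 2 := by
        rw [integral_add (hi1.const_mul 2) (hi2.const_mul 2), integral_const_mul, integral_const_mul, he1, he2]
        ring

/-- The archimedean constant `C_φ = ∫ |φ̂₀(1/2+it)|² (ρ(t) − ρ(0)) dt ≥ 0` of the bump. [folklore] -/
def archConst : ℝ :=
  ∫ t : ℝ, ‖weilMellin (moll 0) (1 / 2 + t * I)‖ ^ 2 * (reDigammaQuarter t - reDigammaQuarter 0)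

/-- `C_φ ≥ 0`. [folklore] -/
theorem archConst_nonneg : 0 ≤ archConst :=
  integral_nonneg fun t ↦ mul_nonneg (sq_nonneg _) (sub_nonneg.2 (reDigammaQuarter_zero_le t))

/-- **Archimedean term of the witness, uniformly in `A`**: `Re W_∞(g_A ⋆ g̃_A) ≤ (2/π) C_φ`. [folklore] -/
theorem re_weilArchTerm_gA_le (A : ℝ) :
    (weilArchTerm (weilConv (gA A) (weilReflect (gA A)))).re ≤ 2 / π * archConst := by
  have hg := isWeilTest_gA A
  set X : ℝ := ∫ t : ℝ, ‖weilMellin (gA A) (1 / 2 + t * I)‖ ^ 2 * reDigammaQuarter t with hX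
  set N : ℝ := ∫ t : ℝ, ‖gA A t‖ ^ 2 with hN
  have harch : weilArchTerm (weilConv (gA A) (weilReflect (gA A))) =
      ((1 / (2 * π) * X - N * Real.log π : ℝ) : ℂ) := by
    unfold weilArchTerm
    rw [weilArchIntegral_weilConv_weilReflect hg, weilConv_weilReflect_apply_zero]
    unfold reDigammaQuarter at hX
    rw [← hX]
    push_cast
    ring
  rw [harch, Complex.ofReal_re]
  have hN0 : 0 ≤ N := integral_nonneg fun t ↦ by positivity
  have hlogπ : 0 ≤ Real.log π := Real.log_nonneg (by linarith [Real.pi_gt_three])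
  -- `X ≤ 4 C_φ` : split `ρ = (ρ − ρ(0)) + ρ(0)`
  have hi_rho : Integrable fun t : ℝ ↦ ‖weilMellin (gA A) (1 / 2 + t * I)‖ ^ 2 * reDigammaQuarter t :=
    integrable_norm_sq_weilMellin_mul_reDigammaQuarter hg
  have hi_sq : Integrable fun t : ℝ ↦ ‖weilMellin (gA A) (1 / 2 + t * I)‖ ^ 2 :=
    integrable_norm_sq_weilMellin_half_line hg
  have hi_m_rho : Integrable fun t : ℝ ↦ ‖weilMellin (moll 0) (1 / 2 + t * I)‖ ^ 2 * reDigammaQuarter t :=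
    integrable_norm_sq_weilMellin_mul_reDigammaQuarter (isWeilTest_moll 0)
  have hi_m_sq : Integrable fun t : ℝ ↦ ‖weilMellin (moll 0) (1 / 2 + t * I)‖ ^ 2 :=
    integrable_norm_sq_weilMellin_half_line (isWeilTest_moll 0)
  have hi_m : Integrable fun t : ℝ ↦
      ‖weilMellin (moll 0) (1 / 2 + t * I)‖ ^ 2 * (reDigammaQuarter t - reDigammaQuarter 0) := by
    have e : (fun t : ℝ ↦ ‖weilMellin (moll 0) (1 / 2 + t * I)‖ ^ 2 * (reDigammaQuarter t - reDigammaQuarter 0)) =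
        fun t : ℝ ↦ ‖weilMellin (moll 0) (1 / 2 + t * I)‖ ^ 2 * reDigammaQuarter t -
          ‖weilMellin (moll 0) (1 / 2 + t * I)‖ ^ 2 * reDigammaQuarter 0 := by
      funext t; ring
    rw [e]
    exact hi_m_rho.sub (hi_m_sq.mul_const _)
  have hsplit : X = (∫ t : ℝ, ‖weilMellin (gA A) (1 / 2 + t * I)‖ ^ 2 * (reDigammaQuarter t - reDigammaQuarter 0)) +
      reDigammaQuarter 0 * (2 * π * weilNorm2Sq (gA A)) := by
    rw [← integral_norm_sq_weilMellin_half_line hg, ← integral_const_mul, ← integral_add]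
    · rw [hX]
      congr 1 with t
      ring
    · have e : (fun t : ℝ ↦ ‖weilMellin (gA A) (1 / 2 + t * I)‖ ^ 2 * (reDigammaQuarter t - reDigammaQuarter 0)) =
          fun t : ℝ ↦ ‖weilMellin (gA A) (1 / 2 + t * I)‖ ^ 2 * reDigammaQuarter t -
            ‖weilMellin (gA A) (1 / 2 + t * I)‖ ^ 2 * reDigammaQuarter 0 := by
        funext t; ring
      rw [e]
      exact hi_rho.sub (hi_sq.mul_const _)
    · exact hi_sq.const_mul _
  have hdiff : (∫ t : ℝ, ‖weilMellin (gA A) (1 / 2 + t * I)‖ ^ 2 * (reDigammaQuarter t - reDigammaQuarter 0)) ≤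
      4 * archConst := by
    unfold archConst
    rw [← integral_const_mul]
    refine integral_mono ?_ (hi_m.const_mul _) fun t ↦ ?_
    · have e : (fun t : ℝ ↦ ‖weilMellin (gA A) (1 / 2 + t * I)‖ ^ 2 * (reDigammaQuarter t - reDigammaQuarter 0)) =
          fun t : ℝ ↦ ‖weilMellin (gA A) (1 / 2 + t * I)‖ ^ 2 * reDigammaQuarter t -
            ‖weilMellin (gA A) (1 / 2 + t * I)‖ ^ 2 * reDigammaQuarter 0 := by
        funext t; ring
      rw [e]
      exact hi_rho.sub (hi_sq.mul_const _)
    · have h1 := norm_sq_weilMellin_gA_half_le A t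
      have h2 : 0 ≤ reDigammaQuarter t - reDigammaQuarter 0 := sub_nonneg.2 (reDigammaQuarter_zero_le t)
      calc ‖weilMellin (gA A) (1 / 2 + t * I)‖ ^ 2 * (reDigammaQuarter t - reDigammaQuarter 0)
          ≤ 4 * ‖weilMellin (moll 0) (1 / 2 + t * I)‖ ^ 2 * (reDigammaQuarter t - reDigammaQuarter 0) :=
            mul_le_mul_of_nonneg_right h1 h2
        _ = 4 * (‖weilMellin (moll 0) (1 / 2 + t * I)‖ ^ 2 * (reDigammaQuarter t - reDigammaQuarter 0)) := by ring
  have hρ0 : reDigammaQuarter 0 < 0 := by linarith [reDigammaQuarter_zero_lt_neg]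
  have hN2 : 0 ≤ weilNorm2Sq (gA A) := hN0
  have hX4 : X ≤ 4 * archConst := by
    rw [hsplit]
    nlinarith [Real.pi_pos, mul_nonneg Real.pi_pos.le hN2]
  have hπ : 0 < π := Real.pi_pos
  calc 1 / (2 * π) * X - N * Real.log π ≤ 1 / (2 * π) * X := by nlinarith
    _ ≤ 1 / (2 * π) * (4 * archConst) := by gcongr
    _ = 2 / π * archConst := by field_simp; ring

/-- The uniform bound `B_S = 8 ‖φ₀‖² M_S + (2/π) C_φ` for prime + archimedean terms of the witness. [folklore] -/
def errConst (S : Finset ℕ) : ℝ := 8 * weilNorm2Sq (moll 0) * weilSemilocalMass S + 2 / π * archConst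

/-- `B_S ≥ 0`. [folklore] -/
theorem errConst_nonneg (S : Finset ℕ) : 0 ≤ errConst S := by
  unfold errConst
  have h1 : 0 ≤ weilNorm2Sq (moll 0) := integral_nonneg fun t ↦ by positivity
  have h2 := weilSemilocalMass_nonneg S
  have h3 := archConst_nonneg
  positivity

/-- The threshold `A₀(S) = 2 B_S / |φ̂₀(0)|² + 1`. [folklore] -/
def threshold (S : Finset ℕ) : ℝ := 2 * errConst S / ‖weilMellin (moll 0) 0‖ ^ 2 + 1

/-- `A₀(S) ≥ 1`. [folklore] -/
theorem one_le_threshold (S : Finset ℕ) : 1 ≤ threshold S := by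
  unfold threshold
  have := div_nonneg (mul_nonneg zero_le_two (errConst_nonneg S)) (sq_nonneg ‖weilMellin (moll 0) 0‖)
  linarith

/-- **The witness is negative**: `Re Q_S(g_A) < 0` for every `A ≥ A₀(S)`. [folklore] -/
theorem re_weilSemilocalQuadratic_gA_neg (S : Finset ℕ) {A : ℝ} (hA : threshold S ≤ A) :
    (weilSemilocalQuadratic S (gA A)).re < 0 := by
  have hg := isWeilTest_gA A
  have hA1 : 1 ≤ A := (one_le_threshold S).trans hA
  have hA0 : 0 ≤ A := by linarith
  set P : ℝ := ‖weilMellin (moll 0) 0‖ ^ 2 with hP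
  have hPpos : 0 < P := norm_sq_weilMellin_moll_zero_pos
  -- polar
  have hpolar : (weilPolarTerm (weilConv (gA A) (weilReflect (gA A)))).re ≤ -(2 * ((A / 2) ^ 2 * P)) := by
    rw [re_weilPolarTerm_weilConv_weilReflect_of_odd hg (gA_neg A)]
    have := sq_mul_le_norm_sq_weilMellin_gA_zero hA0
    linarith
  -- prime
  have hK : ∀ x, ‖weilConv (gA A) (weilReflect (gA A)) x‖ ≤ 4 * weilNorm2Sq (moll 0) := fun x ↦
    (norm_weilConv_weilReflect_le hg x).trans (weilNorm2Sq_gA_le A)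
  have hprime : -(weilSemilocalPrimeTerm S (weilConv (gA A) (weilReflect (gA A)))).re ≤
      8 * weilNorm2Sq (moll 0) * weilSemilocalMass S := by
    have h1 := norm_weilSemilocalPrimeTerm_le S hK
    have h2 := (abs_le.1 (Complex.abs_re_le_norm (weilSemilocalPrimeTerm S (weilConv (gA A) (weilReflect (gA A)))))).1
    linarith
  -- arch
  have harch := re_weilArchTerm_gA_le A
  -- sum
  have hre : (weilSemilocalQuadratic S (gA A)).re =
      (weilPolarTerm (weilConv (gA A) (weilReflect (gA A)))).re -
        (weilSemilocalPrimeTerm S (weilConv (gA A) (weilReflect (gA A)))).re +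
        (weilArchTerm (weilConv (gA A) (weilReflect (gA A)))).re := by
    unfold weilSemilocalQuadratic weilSemilocalFunctional
    rw [Complex.add_re, Complex.sub_re]
  have hB : -(2 * ((A / 2) ^ 2 * P)) + errConst S < 0 := by
    -- `A ≥ 2 B/P + 1` and `A ≥ 1` give `A² P / 2 ≥ A P / 2 ≥ B + P/2 > B`
    have h1 : 2 * errConst S / P + 1 ≤ A := hA
    have h2 : 2 * errConst S + P ≤ A * P := by
      have := mul_le_mul_of_nonneg_right h1 hPpos.le
      rwa [add_mul, one_mul, div_mul_cancel₀ _ hPpos.ne'] at this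
    have h3 : A * P ≤ A ^ 2 * P := by
      have : A ≤ A ^ 2 := by nlinarith
      exact mul_le_mul_of_nonneg_right this hPpos.le
    nlinarith
  rw [hre]
  unfold errConst at hB
  linarith

/-- **Negativity on every large cone**: `¬ WeilSemilocalPositivityOn S a` for `a ≥ A₀(S) + 1`. [folklore] -/
theorem not_weilSemilocalPositivityOn_of_threshold_le (S : Finset ℕ) {a : ℝ} (ha : threshold S + 1 ≤ a) :
    ¬ WeilSemilocalPositivityOn S a := by
  intro h
  have hA : threshold S ≤ a - 1 := by linarith
  have hA0 : 0 ≤ a - 1 := by linarith [one_le_threshold S]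
  have hsupp : tsupport (gA (a - 1)) ⊆ Icc (-a) a := by
    have := tsupport_gA_subset hA0
    rwa [show a - 1 + 1 = a by ring] at this
  have h0 := h (gA (a - 1)) (isWeilTest_gA _) hsupp
  exact absurd h0 (not_le.2 (re_weilSemilocalQuadratic_gA_neg S hA))

end TwoBump

/-! ## The theorems -/

/-- **For every finite `S` the semi-local Weil form is negative on all large cones**:
`∀ᶠ a, ¬ WeilSemilocalPositivityOn S a`. [folklore] -/
theorem eventually_not_weilSemilocalPositivityOn (S : Finset ℕ) :
    ∀ᶠ a : ℝ in atTop, ¬ WeilSemilocalPositivityOn S a :=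
  (eventually_ge_atTop (TwoBump.threshold S + 1)).mono fun _ ha ↦
    TwoBump.not_weilSemilocalPositivityOn_of_threshold_le S ha

/-- **For every finite `S` the semi-local Weil form is negative somewhere**: there is `a > 0` with
`¬ WeilSemilocalPositivityOn S a`. [folklore] -/
theorem exists_not_weilSemilocalPositivityOn (S : Finset ℕ) :
    ∃ a : ℝ, 0 < a ∧ ¬ WeilSemilocalPositivityOn S a :=
  ⟨TwoBump.threshold S + 1, by linarith [TwoBump.one_le_threshold S],
    TwoBump.not_weilSemilocalPositivityOn_of_threshold_le S le_rfl⟩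

/-- **No finite set of places carries support-free semi-local Weil positivity.** [folklore] -/
theorem not_exists_weilSemilocalPositivityOn_forall :
    ¬ ∃ S : Finset ℕ, ∀ a : ℝ, WeilSemilocalPositivityOn S a := by
  rintro ⟨S, hS⟩
  obtain ⟨a, -, ha⟩ := exists_not_weilSemilocalPositivityOn S
  exact ha (hS a)

/-- Equivalently: every finite `S` has a finite positivity threshold — the set of `a` with
`WeilSemilocalPositivityOn S a` is bounded above. [folklore] -/
theorem bddAbove_setOf_weilSemilocalPositivityOn (S : Finset ℕ) :
    BddAbove {a : ℝ | WeilSemilocalPositivityOn S a} := by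
  refine ⟨TwoBump.threshold S + 1, fun a ha ↦ ?_⟩
  by_contra hlt
  rw [not_le] at hlt
  exact TwoBump.not_weilSemilocalPositivityOn_of_threshold_le S hlt.le ha

end Literature.NumberTheory.LFunctions
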